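import Summits.BirchSwinnertonDyer.BirchSwinnertonDyer.Theses.KatoDescentPotSupersingular
import Summits.BirchSwinnertonDyer.BirchSwinnertonDyer.Theorems.KatoDescentPotSupersingularMuCoreIrrConjAThree
import HarnessLib

/-!
# K9 crux `WildCoatesSujathaResidue` (item stmt-BirchSwinnertonDyer-19942, the Conj-A residue of the U₀-ns node
# 19189 / U₀ parent 19197) BY NAME from ONE analytic hypothesis: «on every `E[3]`-irreducible non-CM curve some
# genuine Λ-adic Euler-system class lies outside `3·𝐇¹_Γ(T_3W)`» — CONDITIONAL closer (item stays open)

Seat `bsd-potss-k9-c4` g14 (prover; cell `bsd-potss`); `--supports stmt-BirchSwinnertonDyer-19942 --as helper`;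
closes nothing (conditional-result).  HONEST FRAMING: BSD is not proved by any of this; Conjecture A is NOT proved;
nothing is booked.  The theorem says: the K9 Conj-A residue crux (Coates–Sujatha (A) at `(W, 3)` on the O6 residue
rows, `E[3]` irreducible, tower not onto, non-CM, with the optimal-member side conditions) follows — row conditions
unused — from the displayed hypothesis `hZ`, by k9-c4 g14's unconditional kernel theorem
`MuCoreIrr.exists_fineSelmerDualData_moduleFinite_three_of_irr_of_eulerClass` (the K6 `μ`-core re-run under
`E[3]` irreducible ALONE, parts A–I of the `…MuCoreIrr*` chain).  For Kato's zeta class `hZ` reads «`μ` of the zeta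
ideal of `f_E` at `3` is `0`» — an `L`-VALUE statement, checkable per row by one twisted modular symbol, open
class-wide; it replaces, as the open input of the U₀-ns node on BOTH its sub-rows (Cartan and 9-deficient),
Conjecture A itself.

References: [CoatesSujatha2005] Conjecture A; [Kato2004Asterisque] Thm. 12.5, §13.8; [Serre1972] §2.4–2.6;
HOME pub/bsd-smallim/koly/MU-TRANSFER-PROOF.md.
-/

-- the summit and its single problem are both named `BirchSwinnertonDyer` (registry layout D-0017)
set_option linter.dupNamespace false
set_option autoImplicit false

noncomputable section

open Field WeierstrassCurve
open Literature.NumberTheory.GaloisRepresentations Literature.NumberTheory.EllipticCurves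
open Literature.NumberTheory.EllipticCurves.Kato2004 Literature.NumberTheory.EllipticCurves.Kato2004.EulerSystemValues

namespace Summit.BirchSwinnertonDyer.BirchSwinnertonDyer.Theorems

/-- **`WildCoatesSujathaResidue` (item 19942) from the `3`-indivisibility of a genuine Euler-system class**, by name:
CONDITIONAL closer; the route decl's row conditions (rank `0`, `ClassO6`, tower not onto, optimal member) are not
used — the hypothesis and `E[3]` irreducible suffice (`MuCoreIrr.exists_fineSelmerDualData_moduleFinite_three_of_irr_of_eulerClass`).
[cite: CoatesSujatha2005, §3 and Conjecture A] [cite: Kato2004Asterisque, §13.8 (pp. 228–229)]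
[cite: Serre1972, §2.4 Prop. 15, §2.5–2.6] -/
theorem wildCoatesSujathaResidue_of_eulerClassIndivisible
    (hZ : ∀ (W : WeierstrassCurve ℚ) [W.IsElliptic] [W.IsGloballyMinimal] [Fact (Nat.Prime 3)],
      W.HasIrreducibleModPGaloisRep 3 → ¬ W.HasCM →
      ∀ (κ : ZpExtension ℚ 3), κ.IsCyclotomic →
        letI : ContinuousSMul ℤ_[3] (W.tateModule 3) := TateModule.continuousSMul_padicInt
        haveI : Module.Free ℤ_[3] (W.tateModule 3) := W.module_free_tateModule_holds 3
        haveI : Module.Finite ℤ_[3] (W.tateModule 3) := W.module_finite_tateModule_holds 3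
        ∀ (γ : absoluteGaloisGroup ℚ) (I : IwasawaH1Data W 3 κ γ), κ.IsTopGenerator γ →
          ∃ s : I.H, IsEulerSystemClass W 3 κ γ I s ∧
            s ∉ IwasawaAlgebra.augIdealP 3 • (⊤ : Submodule (IwasawaAlgebra 3) I.H)) :
    Summit.BirchSwinnertonDyer.BirchSwinnertonDyer.Theses.KatoDescentPotSupersingular.WildCoatesSujathaResidue := by
  intro W _ _ _ _hr _hO6 hirr _htower hCM _hopt κ hκ
  exact MuCoreIrr.exists_fineSelmerDualData_moduleFinite_three_of_irr_of_eulerClass W hirr κ hκ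
    (hZ W hirr hCM κ hκ)

end Summit.BirchSwinnertonDyer.BirchSwinnertonDyer.Theorems
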